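import Summits.CriticalPhenomena.PercolationContinuityZ3.Theorems.PercNearOneGluingNoHeavyQuantRootScaledExpansionStep
import HarnessLib

/-!
# QUANT lane R8, T-DEC: THE LAYER-FREE DEC CERTIFICATE `LawDec.DECFree` and the COUNT-LEVEL form of claim (II) — the residual of the
# top-level expansion needs NO hull: `SiblingStep ⟸ ∀ a, resid a (wco a L) L ∈ DECFree (a·x) (a·fmean L)` (census-1 gen 24)

builds on p205010 (kernel theorem, internal audit signed; external expert review pending)

Support + definition file (`--supports stmt-CriticalPhenomena-4575`), QUANT lane seat prim-quant-census-1 (gen 24); memo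
`run/shared/lean/prim/quant/prim-quant-census-1/RESID-DEC-G24.md`.  Two definitions (`LawDec.FreeValid`, `LawDec.DECFree`); theorems with standard axioms, no sorries.
Continues arm-1 g48's `…QuantRootScaledExpansionStep` (`resid`, `decAt_gate_flaw_of_resid`, `sdec_flaw_of_resid`, `siblingStep_of_resid`); uses
`decAt_flaw_of_sdec` (product part) and the list bridge `siblingStep_iff_list` (typer g39).

WHY.  README V428 (lead g46) reads the sibling step at an outer gate `a < 1` through `gate_a(F) = w·P_a + (1 − w)·R_a`; the product part is free
(arm-1 g48), so the node owes, for every `a ∈ (0,1)`, only `DECAt (a·x) j (ftop L) (resid a w L)` for every layer `j` (hypothesis hII of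
`sdec_flaw_of_resid`).  The lane's first instruments for (II) were HULLS (gated blob forests, this seat g23; gated caterpillars, census-2 g74 / typer
g41 `ResidCatCovered`) — sufficient (a member is SDEC) but not necessary, and adverse instances exist for every bounded hull vocabulary (heavy
floors; the gapped family).  The census of this seat (memo §2: 19 217 exact (forest, outer-gate) instances — glued siblings `k = 2..12` at light AND
heavy floors, unequal root gates, the E6 / G40 / gapped families, chains, brooms, blobs, random forests; exact rational LP, certificates re-verified
against the literal `ValidAt` at every layer) finds `R_a` DEC at `a·x` at EVERY layer in EVERY instance, and — except for `k = 2` and all-blob forests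
at floors `≥ .57`, which lie outside the `TreeOK` binder — by ONE certificate valid at all layers simultaneously:
* **`LawDec.DECFree y T M μ`**: `μ = Σ_r λ_r·{lo_r, hi_r; g_r}` (finite, `λ ≥ 0`, `Σ λ = 1`, `lo ≤ hi ≤ M`, `g ∈ [0,1]`) whose charged components
  are SINGLES (`lo = hi`, `T ≤ 2·lo`) or PAIRS (`lo < hi`, `y ≤ g`, `T ≤ 2·lo + (hi − lo)·g`).  Such a component is `ValidAt y T j′` for EVERY `j′`
  (`validAt_of_free`: rule (G) by `y ≤ g` when `hi` is a giant, rule (N) with `κ_y(g) = g` otherwise), so **`decAtT_of_decFree`** /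
  **`decAt_of_decFree`**: DEC at `(y, T)` at every layer.  Tools: `DECFree.antitone_target`, `.mono_floor`, `.mono_top`, `.mix`,
  `decFree_finite_mixture`, constructors `decFree_point`, `decFree_pair`.
* **THE COUNT-LEVEL (II)**: `decAt_resid_of_decFree`, **`decAt_gate_flaw_of_residFree`** (node's obligation at gate `a` from
  `DECFree (a·x) (a·fmean L) (ftop L) (resid a w L)`), **`sdec_flaw_of_residFree`** ((I) below `a₁` ∧ DECFree residual above ⟹ SDEC), and
  **`siblingStep_of_residFree`** — `SiblingStep` from: for every tree-OK list and every `a ∈ (0,1)`, the residual at the weight `wco a L` has a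
  layer-free certificate (the proposed count-level node RESID-DECFree of the memo; its per-layer weakening RESID-DEC is `siblingStep_of_resid`
  with `a₁ ≡ 0`, already kernel).  No `@[conjecture]` is declared here (the typer types nodes on the lead's ruling).
* (The hull bridges — residual in the gated blob / caterpillar hull ⟹ obligation — are typer g41's `decAt_gate_flaw_of_residBlobHull` /
  `decAt_gate_flaw_of_residCatHull` in `…QuantCatHullStep`; not repeated here.)

HONEST STATUS: certificate infrastructure + exact reductions; `SiblingStep`, `GateStepN`, `FarTreeRow` OPEN; RESID-DEC / RESID-DECFree are
EVIDENCE-level (memo §2), not typed here.  RATE class log\* / honest sentence of `run/shared/lean/prim/quant/README.md` unchanged.  [this work];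
expansion: prim-quant-lead g46 (V428) / prim-quant-arm-1 g48; DEC rules ARCH-TREES-G49 / DEC-TAMP-G50 (this lane).  Nothing here is cited as a
published result.  The gluing rows served [cite: KozmaNitzan2024, Conjecture 3 (p. 15)]; product measure [cite: Grimmett1999, §1.3 p. 10].
-/

noncomputable section

open scoped BigOperators

namespace Summit.CriticalPhenomena.PercolationContinuityZ3.Theorems
namespace Quant

open Finset

/-- the two-point law `{lo, hi; g}` (as in `…QuantLawDEC`) -/
local notation3 "TP[" lo ", " hi ", " g ", " h "]" =>
  (g : ℝ) * (if (h : ℕ) = (hi : ℕ) then (1 : ℝ) else 0) + (1 - (g : ℝ)) * (if (h : ℕ) = (lo : ℕ) then (1 : ℝ) else 0)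

namespace LawDec

/-! ### The layer-free certificate -/

/-- **layer-free validity of one component** at floor `y`, target `T`: a SINGLE `lo = hi` with `T ≤ 2·lo`, or a PAIR `lo < hi` with gate
`g ≥ y` and credit `2·lo + (hi − lo)·g ≥ T`. [this work] -/
def FreeValid (y T : ℝ) (lo hi : ℕ) (g : ℝ) : Prop :=
  (lo = hi ∧ T ≤ 2 * (lo : ℝ)) ∨ (lo < hi ∧ y ≤ g ∧ T ≤ 2 * (lo : ℝ) + ((hi : ℝ) - lo) * g)

/-- **`DECFree y T M μ` — THE LAYER-FREE DEC CERTIFICATE**: `μ` on `{0..M}` is an exact finite mixture of two-point components `{lo, hi; g}`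
(`λ ≥ 0`, `Σ λ = 1`, `g ∈ [0,1]`, `lo ≤ hi ≤ M`) every charged one of which is `FreeValid y T`. [this work] -/
def DECFree (y T : ℝ) (M : ℕ) (μ : ℕ → ℝ) : Prop :=
  ∃ (ρ : Type) (_ : Fintype ρ) (lam g : ρ → ℝ) (lo hi : ρ → ℕ),
    (∀ r, 0 ≤ lam r) ∧ (∑ r, lam r = 1) ∧ (∀ r, 0 ≤ g r ∧ g r ≤ 1) ∧ (∀ r, lo r ≤ hi r) ∧ (∀ r, hi r ≤ M) ∧
    (∀ h, μ h = ∑ r, lam r * TP[lo r, hi r, g r, h]) ∧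
    (∀ r, 0 < lam r → FreeValid y T (lo r) (hi r) (g r))

/-- **a layer-free valid component is `ValidAt y T j′` at EVERY layer `j′`**: a single by rule (S); a pair by rule (G) (`y ≤ g`) when `hi ≥ j′+1`
and by rule (N) (credit, `κ_y(g) = g` as `y ≤ g`) when `hi ≤ j′`. [this work] -/
theorem validAt_of_free {y T : ℝ} {lo hi : ℕ} {g : ℝ} (h : FreeValid y T lo hi g) (j' : ℕ) : ValidAt y T j' lo hi g := by
  rcases h with ⟨heq, h2⟩ | ⟨hlt, hyg, hcr⟩
  · exact Or.inl ⟨heq, Or.inl h2⟩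
  · by_cases hgi : j' + 1 ≤ hi
    · exact Or.inr (Or.inl ⟨hlt, hgi, hyg⟩)
    · refine Or.inr (Or.inr ⟨hlt, by omega, ?_⟩)
      rw [if_pos hyg]
      exact hcr

/-- **`DECFree ⟹ DECAtT` AT EVERY LAYER** (same decomposition). [this work] -/
theorem decAtT_of_decFree {y T : ℝ} {M : ℕ} {μ : ℕ → ℝ} (h : DECFree y T M μ) (j' : ℕ) : DECAtT y T j' M μ := by
  obtain ⟨ρ, hρ, lam, g, lo, hi, h0, h1, hg, hlohi, hhi, hμ, hval⟩ := h
  exact ⟨ρ, hρ, lam, g, lo, hi, h0, h1, hg, hlohi, hhi, hμ, fun r hr => validAt_of_free (hval r hr) j'⟩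

/-- **`DECFree` AT THE MEAN ⟹ `DECAt` AT EVERY LAYER.** [this work] -/
theorem decAt_of_decFree {y T : ℝ} {M : ℕ} {μ : ℕ → ℝ} (h : DECFree y T M μ)
    (hT : ∑ k ∈ Finset.range (M + 1), (k : ℝ) * μ k = T) (j' : ℕ) : DECAt y j' M μ := by
  rw [decAt_iff_decAtT, hT]
  exact decAtT_of_decFree h j'

/-- layer-free validity is antitone in the target. [this work] -/
theorem FreeValid.antitone_target {y T T' : ℝ} {lo hi : ℕ} {g : ℝ} (hTT : T' ≤ T) (h : FreeValid y T lo hi g) :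
    FreeValid y T' lo hi g := by
  rcases h with ⟨heq, h2⟩ | ⟨hlt, hyg, hcr⟩
  · exact Or.inl ⟨heq, hTT.trans h2⟩
  · exact Or.inr ⟨hlt, hyg, hTT.trans hcr⟩

/-- layer-free validity is monotone under lowering the floor. [this work] -/
theorem FreeValid.mono_floor {y y' T : ℝ} {lo hi : ℕ} {g : ℝ} (hyy : y' ≤ y) (h : FreeValid y T lo hi g) :
    FreeValid y' T lo hi g := by
  rcases h with ⟨heq, h2⟩ | ⟨hlt, hyg, hcr⟩
  · exact Or.inl ⟨heq, h2⟩
  · exact Or.inr ⟨hlt, hyy.trans hyg, hcr⟩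

/-- `DECFree` is antitone in the target. [this work] -/
theorem DECFree.antitone_target {y T T' : ℝ} {M : ℕ} {μ : ℕ → ℝ} (hTT : T' ≤ T) (h : DECFree y T M μ) : DECFree y T' M μ := by
  obtain ⟨ρ, hρ, lam, g, lo, hi, h0, h1, hg, hlohi, hhi, hμ, hval⟩ := h
  exact ⟨ρ, hρ, lam, g, lo, hi, h0, h1, hg, hlohi, hhi, hμ, fun r hr => (hval r hr).antitone_target hTT⟩

/-- `DECFree` is monotone under lowering the floor. [this work] -/
theorem DECFree.mono_floor {y y' T : ℝ} {M : ℕ} {μ : ℕ → ℝ} (hyy : y' ≤ y) (h : DECFree y T M μ) : DECFree y' T M μ := by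
  obtain ⟨ρ, hρ, lam, g, lo, hi, h0, h1, hg, hlohi, hhi, hμ, hval⟩ := h
  exact ⟨ρ, hρ, lam, g, lo, hi, h0, h1, hg, hlohi, hhi, hμ, fun r hr => (hval r hr).mono_floor hyy⟩

/-- `DECFree` is monotone in the top. [this work] -/
theorem DECFree.mono_top {y T : ℝ} {M M' : ℕ} {μ : ℕ → ℝ} (hMM : M ≤ M') (h : DECFree y T M μ) : DECFree y T M' μ := by
  obtain ⟨ρ, hρ, lam, g, lo, hi, h0, h1, hg, hlohi, hhi, hμ, hval⟩ := h
  exact ⟨ρ, hρ, lam, g, lo, hi, h0, h1, hg, hlohi, fun r => (hhi r).trans hMM, hμ, hval⟩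

/-- **convexity**: `DECFree y T M` is closed under two-term mixtures. [this work] -/
theorem DECFree.mix {y T p : ℝ} {M : ℕ} {μ₁ μ₂ : ℕ → ℝ} (h₁ : DECFree y T M μ₁) (h₂ : DECFree y T M μ₂) (hp0 : 0 ≤ p) (hp1 : p ≤ 1) :
    DECFree y T M (fun h => p * μ₁ h + (1 - p) * μ₂ h) := by
  classical
  obtain ⟨ρ₁, hρ₁, lam₁, g₁, lo₁, hi₁, a0, a1, ag, alohi, ahi, aμ, aval⟩ := h₁
  obtain ⟨ρ₂, hρ₂, lam₂, g₂, lo₂, hi₂, b0, b1, bg, blohi, bhi, bμ, bval⟩ := h₂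
  refine ⟨ρ₁ ⊕ ρ₂, inferInstance, Sum.elim (fun r => p * lam₁ r) (fun r => (1 - p) * lam₂ r), Sum.elim g₁ g₂, Sum.elim lo₁ lo₂,
    Sum.elim hi₁ hi₂, ?_, ?_, ?_, ?_, ?_, fun h => ?_, ?_⟩
  · rintro (r | r)
    · exact mul_nonneg hp0 (a0 r)
    · exact mul_nonneg (by linarith) (b0 r)
  · rw [Fintype.sum_sum_type]
    simp only [Sum.elim_inl, Sum.elim_inr]
    rw [← Finset.mul_sum, ← Finset.mul_sum, a1, b1]
    ring
  · rintro (r | r)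
    · exact ag r
    · exact bg r
  · rintro (r | r)
    · exact alohi r
    · exact blohi r
  · rintro (r | r)
    · exact ahi r
    · exact bhi r
  · rw [Fintype.sum_sum_type]
    simp only [Sum.elim_inl, Sum.elim_inr]
    rw [aμ h, bμ h, Finset.mul_sum, Finset.mul_sum]
    congr 1 <;> refine Finset.sum_congr rfl fun r _ => ?_ <;> ring
  · rintro (r | r) hr
    · simp only [Sum.elim_inl] at hr ⊢
      exact aval r (pos_of_mul_pos_right hr hp0)
    · simp only [Sum.elim_inr] at hr ⊢
      exact bval r (pos_of_mul_pos_right hr (by linarith))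

/-- **charged components only**: a `DECFree` datum may be restricted to its components of positive weight. [this work] -/
theorem decFree_iff_pos (y T : ℝ) (M : ℕ) (μ : ℕ → ℝ) :
    DECFree y T M μ ↔
      ∃ (ρ : Type) (_ : Fintype ρ) (lam g : ρ → ℝ) (lo hi : ρ → ℕ),
        (∀ r, 0 < lam r) ∧ (∑ r, lam r = 1) ∧ (∀ r, 0 ≤ g r ∧ g r ≤ 1) ∧ (∀ r, lo r ≤ hi r) ∧ (∀ r, hi r ≤ M) ∧
        (∀ h, μ h = ∑ r, lam r * TP[lo r, hi r, g r, h]) ∧ (∀ r, FreeValid y T (lo r) (hi r) (g r)) := by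
  classical
  constructor
  · rintro ⟨ρ, hρ, lam, g, lo, hi, h0, h1, hg, hlohi, hhi, hμ, hval⟩
    refine ⟨{r : ρ // 0 < lam r}, inferInstance, fun r => lam r.1, fun r => g r.1, fun r => lo r.1, fun r => hi r.1,
      fun r => r.2, ?_, fun r => hg r.1, fun r => hlohi r.1, fun r => hhi r.1, fun h => ?_, fun r => hval r.1 r.2⟩
    · have e := Finset.sum_subtype (p := fun r => 0 < lam r) (F := inferInstance) (Finset.univ.filter (fun r => 0 < lam r))
        (by intro r; simp) (fun r => lam r)
      rw [← e, Finset.sum_filter, ← h1]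
      refine Finset.sum_congr rfl fun r _ => ?_
      by_cases hp : 0 < lam r
      · rw [if_pos hp]
      · rw [if_neg hp]; exact le_antisymm (h0 r) (not_lt.1 hp)
    · rw [hμ h]
      have e := Finset.sum_subtype (p := fun r => 0 < lam r) (F := inferInstance) (Finset.univ.filter (fun r => 0 < lam r))
        (by intro r; simp) (fun r => lam r * TP[lo r, hi r, g r, h])
      rw [← e, Finset.sum_filter]
      refine Finset.sum_congr rfl fun r _ => ?_
      by_cases hp : 0 < lam r
      · rw [if_pos hp]
      · rw [if_neg hp, ← le_antisymm (h0 r) (not_lt.1 hp), zero_mul]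
  · rintro ⟨ρ, hρ, lam, g, lo, hi, h0, h1, hg, hlohi, hhi, hμ, hval⟩
    exact ⟨ρ, hρ, lam, g, lo, hi, fun r => (h0 r).le, h1, hg, hlohi, hhi, hμ, fun r _ => hval r⟩

/-- **FINITE MIXTURES**: if `μ = Σ_i w_i·ν_i` on a `Fintype`, `w ≥ 0`, `Σ w = 1`, and every CHARGED `ν_i` is `DECFree y T M`, so is `μ`. [this work] -/
theorem decFree_finite_mixture {ι : Type} [Fintype ι] (y T : ℝ) (M : ℕ) (μ : ℕ → ℝ) (w : ι → ℝ) (ν : ι → ℕ → ℝ)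
    (hw0 : ∀ i, 0 ≤ w i) (hw1 : ∑ i, w i = 1) (hμ : ∀ h, μ h = ∑ i, w i * ν i h)
    (hdec : ∀ i, 0 < w i → DECFree y T M (ν i)) : DECFree y T M μ := by
  classical
  have hdec' : ∀ i : {i : ι // 0 < w i}, ∃ (ρ : Type) (_ : Fintype ρ) (lam g : ρ → ℝ) (lo hi : ρ → ℕ),
      (∀ r, 0 < lam r) ∧ (∑ r, lam r = 1) ∧ (∀ r, 0 ≤ g r ∧ g r ≤ 1) ∧ (∀ r, lo r ≤ hi r) ∧ (∀ r, hi r ≤ M) ∧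
      (∀ h, ν i.1 h = ∑ r, lam r * TP[lo r, hi r, g r, h]) ∧ (∀ r, FreeValid y T (lo r) (hi r) (g r)) :=
    fun i => (decFree_iff_pos y T M (ν i.1)).1 (hdec i.1 i.2)
  choose ρf hfin lam g lo hi h0 h1 hg hlohi hhi hν hval using hdec'
  letI : ∀ i, Fintype (ρf i) := hfin
  refine ⟨(Σ i : {i : ι // 0 < w i}, ρf i), inferInstance, fun p => w p.1.1 * lam p.1 p.2, fun p => g p.1 p.2,
    fun p => lo p.1 p.2, fun p => hi p.1 p.2, fun p => (mul_pos p.1.2 (h0 p.1 p.2)).le, ?_, fun p => hg p.1 p.2,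
    fun p => hlohi p.1 p.2, fun p => hhi p.1 p.2, fun h => ?_, fun p _ => hval p.1 p.2⟩
  · rw [Fintype.sum_sigma]
    have e : ∀ i : {i : ι // 0 < w i}, ∑ r : ρf i, w i.1 * lam i r = w i.1 := fun i => by
      rw [← Finset.mul_sum, h1 i, mul_one]
    simp_rw [e]
    have e2 := Finset.sum_subtype (p := fun i => 0 < w i) (F := inferInstance) (Finset.univ.filter (fun i => 0 < w i))
      (by intro i; simp) (fun i => w i)
    rw [← e2, Finset.sum_filter, ← hw1]
    refine Finset.sum_congr rfl fun i _ => ?_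
    by_cases hp : 0 < w i
    · rw [if_pos hp]
    · rw [if_neg hp]; exact le_antisymm (hw0 i) (not_lt.1 hp)
  · rw [hμ h, Fintype.sum_sigma]
    have e : ∀ i : {i : ι // 0 < w i}, ∑ r : ρf i, w i.1 * lam i r * TP[lo i r, hi i r, g i r, h] = w i.1 * ν i.1 h := fun i => by
      rw [hν i h, Finset.mul_sum]
      exact Finset.sum_congr rfl fun r _ => by ring
    simp_rw [e]
    have e2 := Finset.sum_subtype (p := fun i => 0 < w i) (F := inferInstance) (Finset.univ.filter (fun i => 0 < w i))
      (by intro i; simp) (fun i => w i * ν i h)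
    rw [← e2, Finset.sum_filter]
    refine Finset.sum_congr rfl fun i _ => ?_
    by_cases hp : 0 < w i
    · rw [if_pos hp]
    · rw [if_neg hp, ← le_antisymm (hw0 i) (not_lt.1 hp), zero_mul]

/-! ### Constructors -/

/-- **a self-sufficient point** `δ_lo` (`T ≤ 2·lo`, `lo ≤ M`) is `DECFree`. [this work] -/
theorem decFree_point (y T : ℝ) (M lo : ℕ) (hlo : lo ≤ M) (h2 : T ≤ 2 * (lo : ℝ)) :
    DECFree y T M (fun h => if h = lo then (1 : ℝ) else 0) := by
  refine ⟨Unit, inferInstance, fun _ => 1, fun _ => 0, fun _ => lo, fun _ => lo, fun _ => zero_le_one, by simp,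
    fun _ => ⟨le_rfl, zero_le_one⟩, fun _ => le_rfl, fun _ => hlo, fun h => ?_, fun _ _ => Or.inl ⟨rfl, h2⟩⟩
  simp only [Finset.univ_unique, Finset.sum_singleton]
  split_ifs <;> ring

/-- **a floor-heavy credit pair** `{lo, hi; g}` (`lo < hi ≤ M`, `y ≤ g ≤ 1`, `0 ≤ g`, `T ≤ 2·lo + (hi − lo)·g`) is `DECFree`. [this work] -/
theorem decFree_pair (y T : ℝ) (M lo hi : ℕ) (g : ℝ) (hlt : lo < hi) (hhi : hi ≤ M) (hg0 : 0 ≤ g) (hg1 : g ≤ 1) (hyg : y ≤ g)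
    (hcr : T ≤ 2 * (lo : ℝ) + ((hi : ℝ) - lo) * g) : DECFree y T M (fun h => TP[lo, hi, g, h]) :=
  ⟨Unit, inferInstance, fun _ => 1, fun _ => g, fun _ => lo, fun _ => hi, fun _ => zero_le_one, by simp, fun _ => ⟨hg0, hg1⟩,
    fun _ => hlt.le, fun _ => hhi, fun h => by simp, fun _ _ => Or.inr ⟨hlt, hyg, hcr⟩⟩

/-! ### The count-level form of claim (II): the residual with a layer-free certificate -/

/-- **THE RESIDUAL WITH A LAYER-FREE CERTIFICATE IS DEC AT EVERY LAYER** (`0 < a ≤ 1`, `w ≤ wco a L`, `w < 1`; the residual's mean is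
`a·fmean L`, `resid_laws`). [this work] -/
theorem decAt_resid_of_decFree {x a w : ℝ} (ha0 : 0 < a) (ha1 : a ≤ 1) (L : List Sib) (hL : ∀ s ∈ L, s.LawOK)
    (hw : w ≤ wco a L) (hw1 : w < 1) (hR : DECFree (a * x) (a * fmean L) (ftop L) (resid a w L)) :
    ∀ j, DECAt (a * x) j (ftop L) (resid a w L) := by
  obtain ⟨_, _, _, rmn⟩ := resid_laws ha0 ha1 L hL hw hw1
  exact fun j => decAt_of_decFree hR rmn j

/-- **THE NODE'S OBLIGATION AT OUTER GATE `a` FROM A LAYER-FREE CERTIFICATE OF THE RESIDUAL.**  Tree-built siblings at floor `0 < x < 1` with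
SDEC sub-forest laws, `0 < a ≤ 1`, `0 ≤ w ≤ wco a L`, `w < 1`: if `resid a w L ∈ DECFree (a·x) (a·fmean L)`, then `gate (flaw L) a` is DEC at
floor `a·x` at every layer below the top (product part free, arm-1 g48 `decAt_gate_flaw_of_resid`). [this work] -/
theorem decAt_gate_flaw_of_residFree {x a w : ℝ} (hx0 : 0 < x) (hx1 : x < 1) (ha0 : 0 < a) (ha1 : a ≤ 1)
    (L : List Sib) (hL : ∀ s ∈ L, s.TreeOK x) (hρ : ∀ s ∈ L, SDEC s.x₁ s.M s.ρ)
    (hw0 : 0 ≤ w) (hw : w ≤ wco a L) (hw1 : w < 1)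
    (hR : DECFree (a * x) (a * fmean L) (ftop L) (resid a w L))
    (j : ℕ) (hj : j < ftop L) : DECAt (a * x) j (ftop L) (gate (flaw L) a) :=
  decAt_gate_flaw_of_resid hx0 hx1 ha0 ha1 L hL hρ hw0 hw hw1
    (fun j _ => decAt_resid_of_decFree ha0 ha1 L (fun s hs => (hL s hs).lawOK) hw hw1 hR j) j hj

/-- **SDEC OF THE FOREST FROM (I) BELOW A THRESHOLD AND LAYER-FREE RESIDUAL CERTIFICATES ABOVE IT.**  Tree-built siblings at floor `0 < x < 1`
with SDEC sub-forest laws; a threshold `a₁` and a weight schedule `w`: (I) for `0 < a ≤ a₁` (`a < 1`) the gated forest is DEC at `a·x` at every layer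
below the top; (II-free) for `a₁ < a < 1`, `resid a (w a) L ∈ DECFree (a·x) (a·fmean L)` with `0 ≤ w a ≤ wco a L`, `w a < 1`.  Then `flaw L` is
SDEC at `x`. [this work] -/
theorem sdec_flaw_of_residFree {x : ℝ} (hx0 : 0 < x) (hx1 : x < 1) (L : List Sib) (hL : ∀ s ∈ L, s.TreeOK x)
    (hρ : ∀ s ∈ L, SDEC s.x₁ s.M s.ρ) (a₁ : ℝ) (w : ℝ → ℝ)
    (hI : ∀ a, 0 < a → a ≤ a₁ → a < 1 → ∀ j, j < ftop L → DECAt (a * x) j (ftop L) (gate (flaw L) a))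
    (hw : ∀ a, a₁ < a → 0 < a → a < 1 → 0 ≤ w a ∧ w a ≤ wco a L ∧ w a < 1)
    (hII : ∀ a, a₁ < a → 0 < a → a < 1 → DECFree (a * x) (a * fmean L) (ftop L) (resid a (w a) L)) :
    SDEC x (ftop L) (flaw L) := by
  intro a ha0 ha1 j hj
  rcases eq_or_lt_of_le ha1 with rfl | hlt
  · rw [gate_one, one_mul]
    exact decAt_flaw_of_sdec hx0 hx1 L hL hρ j
  · by_cases hle : a ≤ a₁
    · exact hI a ha0 hle hlt j hj
    · obtain ⟨hw0, hwle, hw1⟩ := hw a (not_le.1 hle) ha0 hlt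
      exact decAt_gate_flaw_of_residFree hx0 hx1 ha0 ha1 L hL hρ hw0 hwle hw1 (hII a (not_le.1 hle) ha0 hlt) j hj

/-- **SDEC OF THE FOREST FROM LAYER-FREE RESIDUAL CERTIFICATES AT EVERY OUTER GATE** (the canonical weight `wco a L`; at least two siblings, so
that `wco a L < 1` for `a < 1`). [this work] -/
theorem sdec_flaw_of_residFree_all {x : ℝ} (hx0 : 0 < x) (hx1 : x < 1) (L : List Sib) (hL : ∀ s ∈ L, s.TreeOK x)
    (hρ : ∀ s ∈ L, SDEC s.x₁ s.M s.ρ) (hk : 2 ≤ L.length)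
    (hII : ∀ a, 0 < a → a < 1 → DECFree (a * x) (a * fmean L) (ftop L) (resid a (wco a L) L)) :
    SDEC x (ftop L) (flaw L) := by
  have hL' : ∀ s ∈ L, s.LawOK := fun s hs => (hL s hs).lawOK
  intro a ha0 ha1 j hj
  rcases eq_or_lt_of_le ha1 with rfl | hlt
  · rw [gate_one, one_mul]
    exact decAt_flaw_of_sdec hx0 hx1 L hL hρ j
  · obtain ⟨hW0, _, _⟩ := wco_facts hlt.le L hL'
    have hw1 : wco a L < 1 := by
      rcases L with _ | ⟨s, _ | ⟨t, L⟩⟩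
      · simp at hk
      · simp at hk
      · exact wco_lt_one hlt s t L hL'
    exact decAt_gate_flaw_of_residFree hx0 hx1 ha0 hlt.le L hL hρ hW0.le le_rfl hw1 (hII a ha0 hlt) j hj

/-- **KERNEL SKELETON `SiblingStep ⟸ RESID-DECFree`** (memo RESID-DEC-G24 §1): if for every forest of `k ≥ 3` tree-built siblings (list binder,
under the oracle of the sibling step) and every outer gate `0 < a < 1` the residual `resid a (wco a L) L` has a layer-free certificate
`DECFree (a·x) (a·fmean L) (ftop L)`, then `SiblingStep` holds (hence `GateStepN`, `SDECConvClosedTB`, `Quant.FarTreeRow`). [this work] -/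
theorem siblingStep_of_residFree
    (hII : ∀ (x : ℝ) (L : List Sib), 0 < x → x < 1 → (∀ s ∈ L, s.TreeOK x) → 3 ≤ L.length →
      (∀ (x' : ℝ) (n' M' : ℕ) (μ' : ℕ → ℝ), n' < fgates L → TreeBuiltN x' n' M' μ' → SDEC x' M' μ') →
      ∀ a, 0 < a → a < 1 → DECFree (a * x) (a * fmean L) (ftop L) (resid a (wco a L) L)) :
    SiblingStep := by
  rw [siblingStep_iff_list]
  intro x L hx0 hx1 hL hk hO
  exact sdec_flaw_of_residFree_all hx0 hx1 L hL (sdec_members_of_oracle L hL hO) (by omega) (hII x L hx0 hx1 hL hk hO)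

end LawDec
end Quant
end Summit.CriticalPhenomena.PercolationContinuityZ3.Theorems
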